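import Summits.Ventures.Crystal3D.Theorems.StickyWulffConstantCoaxialWallLawWordMoves
import Summits.Ventures.Crystal3D.Theorems.StickyWulffConstantCoaxialWallLawWordTargets
import Summits.Ventures.Crystal3D.Theorems.StickyWulffConstantGenericWallFloorCredits
import HarnessLib

/-!
# The word automaton of the co-axial cell, IV: a move lands on a certified state one unit away

HONEST FRAMING. Part of the venture `Summits/Ventures/Crystal3D` (cell `crystal3d-full`), helper for the
crux `CoaxialWallLaw` (stmt-Ventures-19481) of `route-Ventures-StickyWulffConstant`, REGISTERED line
`WallLedgerF` (planner cf-p1 gen 16), open stub `stub_coaxialTwoSlabAdhesion` (general fillings).  Brick W4 of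
the v2 (NET) line automaton (memo F-NET-AUTOMATON-v2 §7, evidence on the crux item).  Rung credit only; F-C1 not
moved.

With the abstract classes of `…WordMoves` (frames `F`, directions `d κ = F κ u_κ`, class change `next` along
crossing normals, mirror relation, involution) and CERTIFIED states (`b ∈ X`, a `60°` triangle of
`F κ`-neighbours in `X`, `b − d κ ∈ X`):

* `shell_slot_of_full` — if `s` has a full `G`-shell in `X` and `s + x ∈ X` with `‖x‖ = 1`, then `x` is a
  `G`-slot (else thirteen contacts, `card_filter_dist_eq_one_le_twelve`);
* `word_move_target` — the image `f v = (b', κ')` of a moving certified state is certified, `b' − d κ' = b`,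
  and `dist b b' = 1` (full step / cross / glide: `…WordTargets`).

WHAT THIS IS NOT: not the stub; F-C1 not moved.
-/

noncomputable section

namespace Summit.Ventures.Crystal3D.Theorems

open Summit.Ventures.Crystal3D Finset
open Literature.MathematicalPhysics.StatisticalMechanics (fccStacking)
open scoped InnerProductSpace

variable {X : Finset (EuclideanSpace ℝ (Fin 3))}

open scoped Classical in
/-- **A unit neighbour of a ball with a full shell is a slot of that shell.** -/
theorem shell_slot_of_full (hX : ∀ p ∈ X, ∀ q ∈ X, p ≠ q → 1 ≤ dist p q)
    (G : EuclideanSpace ℝ (Fin 3) ≃ₗᵢ[ℝ] EuclideanSpace ℝ (Fin 3)) {s x : EuclideanSpace ℝ (Fin 3)}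
    (hfull : ∀ w ∈ fccSlots, s + G w ∈ X) (hx : s + x ∈ X) (hnx : ‖x‖ = 1) :
    ∃ w ∈ fccSlots, G w = x := by
  by_contra hno
  push Not at hno
  have hcard : (insert (s + x) (fccSlots.image fun w => s + G w)).card = 13 := by
    rw [card_insert_of_notMem, card_image_of_injective, card_fccSlots]
    · intro w₁ w₂ hw
      exact G.injective (add_left_cancel hw)
    · intro hmem
      obtain ⟨w, hw, hwe⟩ := mem_image.1 hmem
      exact hno w hw (add_left_cancel hwe)
  have hsub : insert (s + x) (fccSlots.image fun w => s + G w) ⊆ X.filter fun q => dist s q = 1 := by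
    intro q hq
    rw [mem_filter]
    rcases mem_insert.1 hq with rfl | hq'
    · exact ⟨hx, by rw [dist_eq_norm, sub_add_cancel_left, norm_neg, hnx]⟩
    · obtain ⟨w, hw, rfl⟩ := mem_image.1 hq'
      exact ⟨hfull w hw, by rw [dist_eq_norm, sub_add_cancel_left, norm_neg, LinearIsometryEquiv.norm_map,
        norm_eq_one_of_mem_fccSlots hw]⟩
  have h12 := card_filter_dist_eq_one_le_twelve X hX s
  have := card_le_card hsub
  omega

section Step

variable {K : Type*} {F : K → (EuclideanSpace ℝ (Fin 3) ≃ₗᵢ[ℝ] EuclideanSpace ℝ (Fin 3))}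
  {d : K → EuclideanSpace ℝ (Fin 3)} {next : K → EuclideanSpace ℝ (Fin 3) → K}
  {W : Finset (EuclideanSpace ℝ (Fin 3) × K)}
  {f : EuclideanSpace ℝ (Fin 3) × K → EuclideanSpace ℝ (Fin 3) × K}

/-- **A move lands on a certified state one unit away.**  See the module docstring.  `W` is the set of
certified states (membership iff: ball in `X`, triangle certificate, predecessor ball in `X`). -/
theorem word_move_target
    (hd : ∀ κ, ∃ u ∈ fccSlots, d κ = F κ u)
    (hdn : ∀ κ, ∃ m : EuclideanSpace ℝ (Fin 3), ‖m‖ = 1 ∧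
      (∀ w ∈ fccSlots, ⟪F κ w, m⟫_ℝ = 0 ∨ ⟪F κ w, m⟫_ℝ = Real.sqrt (2 / 3) ∨ ⟪F κ w, m⟫_ℝ = -Real.sqrt (2 / 3)) ∧
      ⟪d κ, m⟫_ℝ = Real.sqrt (2 / 3))
    (hmirror : ∀ κ (m : EuclideanSpace ℝ (Fin 3)), ‖m‖ = 1 →
      (∀ w ∈ fccSlots, ⟪F κ w, m⟫_ℝ = 0 ∨ ⟪F κ w, m⟫_ℝ = Real.sqrt (2 / 3) ∨ ⟪F κ w, m⟫_ℝ = -Real.sqrt (2 / 3)) →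
      ⟪d κ, m⟫_ℝ = Real.sqrt (2 / 3) → ∀ x, F (next κ m) x = F κ x - (2 * ⟪F κ x, m⟫_ℝ) • m)
    (hdnext : ∀ κ (m : EuclideanSpace ℝ (Fin 3)), ‖m‖ = 1 →
      (∀ w ∈ fccSlots, ⟪F κ w, m⟫_ℝ = 0 ∨ ⟪F κ w, m⟫_ℝ = Real.sqrt (2 / 3) ∨ ⟪F κ w, m⟫_ℝ = -Real.sqrt (2 / 3)) →
      ⟪d κ, m⟫_ℝ = Real.sqrt (2 / 3) → ⟪d (next κ m), m⟫_ℝ = Real.sqrt (2 / 3))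
    (hW : ∀ v, v ∈ W ↔ (v.1 ∈ X ∧
      (∃ a ∈ fccSlots, ∃ a' ∈ fccSlots, ∃ a'' ∈ fccSlots,
        ⟪a, a'⟫_ℝ = 1 / 2 ∧ ⟪a, a''⟫_ℝ = 1 / 2 ∧ ⟪a', a''⟫_ℝ = 1 / 2 ∧
        v.1 + F v.2 a ∈ X ∧ v.1 + F v.2 a' ∈ X ∧ v.1 + F v.2 a'' ∈ X) ∧
      v.1 - d v.2 ∈ X))
    (hf_full : ∀ v ∈ W, (∀ w ∈ fccSlots, v.1 + F v.2 w ∈ X) → f v = (v.1 + d v.2, v.2))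
    (hf_cross : ∀ v ∈ W, ∀ m : EuclideanSpace ℝ (Fin 3), ‖m‖ = 1 →
      (∀ w ∈ fccSlots, ⟪F v.2 w, m⟫_ℝ = 0 ∨ ⟪F v.2 w, m⟫_ℝ = Real.sqrt (2 / 3) ∨ ⟪F v.2 w, m⟫_ℝ = -Real.sqrt (2 / 3)) →
      (∀ w ∈ fccSlots, ⟪F v.2 w, m⟫_ℝ ≤ 0 → v.1 + F v.2 w ∈ X) →
      (∀ w ∈ fccSlots, ⟪F v.2 w, m⟫_ℝ < 0 → v.1 + (F v.2 w - (2 * ⟪F v.2 w, m⟫_ℝ) • m) ∈ X) →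
      (∀ w ∈ fccSlots, 0 < ⟪F v.2 w, m⟫_ℝ → v.1 + F v.2 w ∉ X) →
      ⟪d v.2, m⟫_ℝ = Real.sqrt (2 / 3) → f v = (v.1 + d (next v.2 m), next v.2 m))
    (hf_glide : ∀ v ∈ W, ∀ m : EuclideanSpace ℝ (Fin 3), ‖m‖ = 1 →
      (∀ w ∈ fccSlots, ⟪F v.2 w, m⟫_ℝ = 0 ∨ ⟪F v.2 w, m⟫_ℝ = Real.sqrt (2 / 3) ∨ ⟪F v.2 w, m⟫_ℝ = -Real.sqrt (2 / 3)) →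
      (∀ w ∈ fccSlots, ⟪F v.2 w, m⟫_ℝ ≤ 0 → v.1 + F v.2 w ∈ X) →
      (∀ w ∈ fccSlots, ⟪F v.2 w, m⟫_ℝ < 0 → v.1 + (F v.2 w - (2 * ⟪F v.2 w, m⟫_ℝ) • m) ∈ X) →
      (∀ w ∈ fccSlots, 0 < ⟪F v.2 w, m⟫_ℝ → v.1 + F v.2 w ∉ X) →
      ⟪d v.2, m⟫_ℝ = 0 → f v = (v.1 + d v.2, v.2))
    {v : EuclideanSpace ℝ (Fin 3) × K} (hv : v ∈ W)
    (hmov : (∀ w ∈ fccSlots, v.1 + F v.2 w ∈ X) ∨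
      ∃ m : EuclideanSpace ℝ (Fin 3), ‖m‖ = 1 ∧
        (∀ w ∈ fccSlots, ⟪F v.2 w, m⟫_ℝ = 0 ∨ ⟪F v.2 w, m⟫_ℝ = Real.sqrt (2 / 3) ∨ ⟪F v.2 w, m⟫_ℝ = -Real.sqrt (2 / 3)) ∧
        (∀ w ∈ fccSlots, ⟪F v.2 w, m⟫_ℝ ≤ 0 → v.1 + F v.2 w ∈ X) ∧
        (∀ w ∈ fccSlots, ⟪F v.2 w, m⟫_ℝ < 0 → v.1 + (F v.2 w - (2 * ⟪F v.2 w, m⟫_ℝ) • m) ∈ X) ∧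
        (∀ w ∈ fccSlots, 0 < ⟪F v.2 w, m⟫_ℝ → v.1 + F v.2 w ∉ X) ∧
        (⟪d v.2, m⟫_ℝ = Real.sqrt (2 / 3) ∨ ⟪d v.2, m⟫_ℝ = 0)) :
    f v ∈ W ∧ (f v).1 - d (f v).2 = v.1 ∧ dist v.1 (f v).1 = 1 := by
  have hr : 0 < Real.sqrt (2 / 3) := Real.sqrt_pos.2 (by norm_num)
  obtain ⟨hbX, -, -⟩ := (hW v).1 hv
  -- unit step along a vector `x = F κ' u`: the three conclusions from the target data
  have finish : ∀ (κ' : K) (x : EuclideanSpace ℝ (Fin 3)), f v = (v.1 + x, κ') → d κ' = x → ‖x‖ = 1 →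
      v.1 + x ∈ X →
      (∃ a ∈ fccSlots, ∃ a' ∈ fccSlots, ∃ a'' ∈ fccSlots,
        ⟪a, a'⟫_ℝ = 1 / 2 ∧ ⟪a, a''⟫_ℝ = 1 / 2 ∧ ⟪a', a''⟫_ℝ = 1 / 2 ∧
        v.1 + x + F κ' a ∈ X ∧ v.1 + x + F κ' a' ∈ X ∧ v.1 + x + F κ' a'' ∈ X) →
      f v ∈ W ∧ (f v).1 - d (f v).2 = v.1 ∧ dist v.1 (f v).1 = 1 := by
    intro κ' x hfv hdx hnx hxX htri
    rw [hfv]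
    refine ⟨(hW _).2 ⟨hxX, htri, ?_⟩, ?_, ?_⟩
    · show v.1 + x - d κ' ∈ X
      rw [hdx, add_sub_cancel_right]; exact hbX
    · show v.1 + x - d κ' = v.1
      rw [hdx, add_sub_cancel_right]
    · show dist v.1 (v.1 + x) = 1
      rw [dist_eq_norm, sub_add_cancel_left, norm_neg, hnx]
  obtain ⟨u, hu, hdu⟩ := hd v.2
  by_cases hfull : ∀ w ∈ fccSlots, v.1 + F v.2 w ∈ X
  · -- full step
    obtain ⟨m, hm, hmenu, hdm⟩ := hdn v.2
    refine finish v.2 (d v.2) (hf_full v hv hfull) rfl ?_ ?_ ?_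
    · rw [hdu, LinearIsometryEquiv.norm_map, norm_eq_one_of_mem_fccSlots hu]
    · rw [hdu]; exact hfull u hu
    · rw [hdu]
      exact triangle_after_full_step (F v.2) hm hmenu hbX hfull hu (by rw [← hdu]; exact hdm)
  · obtain ⟨m, hm, hmenu, hown, hmir, hfar, hdm⟩ := hmov.resolve_left hfull
    rcases hdm with hdm | hdm
    · -- cross
      obtain ⟨u', hu', hdu'⟩ := hd (next v.2 m)
      have hFm := hmirror v.2 m hm hmenu hdm
      have hdm' := hdnext v.2 m hm hmenu hdm
      have hneg : ⟪F v.2 u', m⟫_ℝ = -Real.sqrt (2 / 3) := by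
        have h := hdm'
        rw [hdu', hFm, inner_sub_left, real_inner_smul_left, real_inner_self_eq_norm_sq, hm] at h
        linarith
      refine finish (next v.2 m) (d (next v.2 m)) (hf_cross v hv m hm hmenu hown hmir hfar hdm) rfl ?_ ?_ ?_
      · rw [hdu', LinearIsometryEquiv.norm_map, norm_eq_one_of_mem_fccSlots hu']
      · rw [hdu', hFm]; exact hmir u' hu' (by rw [hneg]; linarith)
      · rw [hdu']
        exact triangle_after_cross (F v.2) (F (next v.2 m)) hm hmenu hFm hbX hmir hu' (by rw [← hdu']; exact hdm')
    · -- glide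
      refine finish v.2 (d v.2) (hf_glide v hv m hm hmenu hown hmir hfar hdm) rfl ?_ ?_ ?_
      · rw [hdu, LinearIsometryEquiv.norm_map, norm_eq_one_of_mem_fccSlots hu]
      · rw [hdu]; exact hown u hu (by rw [← hdu, hdm])
      · rw [hdu]
        exact triangle_after_glide (F v.2) hm hmenu hbX hown hu (by rw [← hdu]; exact hdm)

end Step

end Summit.Ventures.Crystal3D.Theorems

end
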